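import Summits.HubbardSuperconductivity.HubbardSuperconductivity.Theorems.LevyLogBootstrapDressHalfFilledPlaquetteData
import Literature.MathematicalPhysics.QuantumLattice.InterClusterKernelSymmetries
import HarnessLib

/-!
# Crux `DressHalfFilled` (stmt-HubbardSuperconductivity-8148, route `LevyLogBootstrap`; shared with route
# `AnisotropyChord` and, for stubs 1–2, with crux stmt-10291 `DressAnyFilling`): SYMMETRIES OF KATO'S TWO-PLAQUETTE
# KERNEL for `U ∈ [2, 4]` — reflection symmetry of the shifts, reality of the pair hopping, isotropy, gauge/choice
# independence

Support file (`--supports stmt-HubbardSuperconductivity-8148`) for stubs 1–2 of the line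
`Cruxes/DressHalfFilled/Lines/birth.lean`. The plaquette pair-boson dictionary `plaquettePairCouplings U`
(`Literature/…/PlaquettePairCouplings.lean`: `J = -Re K((1,0),(0,1))`, `V`, `μ`, `c`, `Δ_eff = -V/2J`, with
`K = plaquetteKernel U` Kato's second-order kernel of two HORIZONTALLY adjacent plaquettes built from the CHOSEN sector
ground states `plaquetteStates U = ![|0h⟩, |2h⟩]`) enters stub 1 through (W1) `0 < J, 0 ≤ V < 2J` and stub 2 through
clause (d), `T S(E₀) T = -(2J · xxzHamiltonian 1 (torusGraph 2 M) (-1) Δ_eff + k(N_b))` — an ISOTROPIC `S = ½` XXZ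
model with a REAL hopping `J` on the plaquette torus, although the inter-plaquette hopping `T` has horizontal AND
vertical bonds and the kernel entry `K((1,0),(0,1))` is a priori complex and choice dependent ("`J`, `V`, `μ` are
invariant under rephasing the two states; this is NOT proved here", `PlaquettePairCouplings.lean`).

THIS FILE PROVES, for every `U ∈ [2, 4]` (where (W4), the simplicity of the `(4,0)` and `(2,0)` sector ground states,
is the theorem `plaquette_vacuumGS_unique` / `plaquette_pairGS_unique` of `…DressHalfFilledPlaquetteData`), from the
abstract symmetry theory `Literature/…/InterClusterKernelSymmetries.lean` and the second-quantised lattice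
symmetries `fockMapOp` (`Literature/…/FockMapOp.lean`), and WITHOUT the `B₁g`/`A₁` labels of the two states:

* `plaquetteStates_eigenphase`: every graph automorphism `f` of the plaquette `C₄` acts on `|0h⟩`, `|2h⟩` by
  unimodular scalars (`Γ_f` permutes the simple sector ground states);
* `plaquetteKernel_mapEquiv_diag/_exchange`: hence the diagonal entries (second-order shifts) and the exchange
  entries (pair hoppings) of the kernel are unchanged when the bond set is pulled back along `f`;
* `plaquetteKernel_reflect`: with `f = (x,y) ↦ (x+1,y)` (which maps the boundary bonds onto their transposes):
  `K((k,l),(k,l)) = K((l,k),(l,k))` — in particular `δE(1,0) = δE(0,1)`, the hypothesis of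
  `plaquettePairCouplings_V_eq_of_symm`, so `V = δE(1,1) + δE(0,0) - 2δE(1,0)` (`plaquettePairCouplings_V_eq`) and the
  two one-body shifts agree (`plaquettePairCouplings_mu_symm`);
* `plaquetteKernel_exchange_im`: the pair-hopping entry is REAL, `Im K((1,0),(0,1)) = 0`, so
  `K((1,0),(0,1)) = -J(U)` exactly (`plaquetteKernel_hop_eq_neg_J`) — the reflection composed with the cluster
  exchange is complex conjugation on this entry;
* `plaquetteKernel_vertical_diag/_exchange`: with `f = (x,y) ↦ (y,x)`: the kernel of two VERTICALLY adjacent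
  plaquettes (bond set `plaquetteBondsV`, top row of `R` to bottom row of `R + 2e₂`) has the same shifts and the same
  pair hopping as the horizontal one — the effective boson model is isotropic, as clause (d) of stub 2 requires;
* `plaquetteKernel_choice_diag/_exchange`, `plaquetteDWaveOverlap_choice`: ANY pair of normalised sector ground states
  gives the same shifts, the same pair hopping and the same `|⟨2h| Δ_d |0h⟩| = c(U)` — `J, V, μ, c` are functions of
  `U` alone on `[2, 4]`.

Registered sub-goal stubs (signatures verbatim at the end): `dressHalfFilled_kernelReflect`,
`dressHalfFilled_kernelHopReal`, `dressHalfFilled_kernelIsotropic`.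

Sources: W.-F. Tsai, S. A. Kivelson, PRB 73 (2006) 214510, App. A (A1)–(A3) [TsaiKivelson2006]; H. Yao, W.-F. Tsai,
S. A. Kivelson, PRB 76 (2007) 161104(R), eq. (2), p. 2 and p. 4 (nondegenerate plaquette states; the isotropic boson
model `-t Σ b†b + V Σ ρρ` on the square superlattice) [YaoTsaiKivelson2007]; T. Kato (1966), I-§5.3 [Kato1966].
No named fact is introduced; the three auxiliary `def`s are the two plaquette automorphisms and the vertical bond set.
-/

noncomputable section

set_option linter.dupNamespace false

namespace Summit.HubbardSuperconductivity.HubbardSuperconductivity.Theorems.LevyLogBootstrap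

open Matrix Finset Literature.MathematicalPhysics.QuantumLattice Literature.Probability.LatticeModels
open scoped ComplexOrder

section KernelSymmetry

variable {U : ℝ}

/-! ### Two automorphisms of the plaquette and the vertical bond set -/

/-- The horizontal unit shift `(x, y) ↦ (x + 1, y)` of the `2 × 2` plaquette (`= the reflection x ↦ 1 - x`): it
exchanges the right column of a plaquette with its left column, i.e. maps the two horizontal boundary bonds
`((1,y),(0,y))` onto their transposes. [folklore] -/
def plaquetteXShift : PlaquetteSite ≃ PlaquetteSite where
  toFun p := toLex ![ofLex p 0 + 1, ofLex p 1]
  invFun p := toLex ![ofLex p 0 + 1, ofLex p 1]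
  left_inv := by decide
  right_inv := by decide

/-- The diagonal reflection `(x, y) ↦ (y, x)` of the `2 × 2` plaquette: it maps the horizontal boundary bonds onto
the vertical ones. [folklore] -/
def plaquetteDiagSwap : PlaquetteSite ≃ PlaquetteSite where
  toFun p := toLex ![ofLex p 1, ofLex p 0]
  invFun p := toLex ![ofLex p 1, ofLex p 0]
  left_inv := by decide
  right_inv := by decide

/-- The two `t'`-bonds joining a plaquette `R` (cluster 1) to its UPPER neighbour `R' = R + 2e₂` (cluster 2): the
top row `(x, 1)` of `R` to the bottom row `(x, 0)` of `R'`, `x = 0, 1` (the vertical analogue of `plaquetteBonds`).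
Yao–Tsai–Kivelson 2007, Fig. 1 (dashed bonds). [folklore] -/
def plaquetteBondsV : Finset (PlaquetteSite × PlaquetteSite) :=
  {(toLex ![0, 1], toLex ![0, 0]), (toLex ![1, 1], toLex ![1, 0])}

/-- The horizontal shift is an automorphism of the plaquette graph `C₄`. [folklore] -/
theorem plaquetteGraph_adj_xShift :
    ∀ x y : PlaquetteSite, plaquetteGraph.Adj (plaquetteXShift x) (plaquetteXShift y) ↔ plaquetteGraph.Adj x y := by
  decide

/-- The diagonal reflection is an automorphism of the plaquette graph `C₄`. [folklore] -/
theorem plaquetteGraph_adj_diagSwap :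
    ∀ x y : PlaquetteSite,
      plaquetteGraph.Adj (plaquetteDiagSwap x) (plaquetteDiagSwap y) ↔ plaquetteGraph.Adj x y := by
  decide

/-- Pulling the horizontal bonds back along the horizontal shift transposes them. [folklore] -/
theorem plaquetteBonds_map_xShift :
    plaquetteBonds.map ((plaquetteXShift.prodCongr plaquetteXShift).symm.toEmbedding) =
      plaquetteBonds.map (Equiv.prodComm PlaquetteSite PlaquetteSite).toEmbedding := by
  decide

/-- Pulling the horizontal bonds back along the diagonal reflection gives the vertical bonds. [folklore] -/
theorem plaquetteBonds_map_diagSwap :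
    plaquetteBonds.map ((plaquetteDiagSwap.prodCongr plaquetteDiagSwap).symm.toEmbedding) = plaquetteBondsV := by
  decide

/-- On the orbitals: the horizontal bond hopping pulled back along the horizontal shift is the TRANSPOSED hopping
matrix. [folklore] -/
theorem bondHopping_plaquetteBonds_xShift :
    (fun i j : Orb PlaquetteSite =>
        bondHopping plaquetteBonds (Orb.mapEquiv plaquetteXShift i) (Orb.mapEquiv plaquetteXShift j)) =
      fun i j => bondHopping plaquetteBonds j i := by
  funext i j
  rw [bondHopping_mapEquiv, plaquetteBonds_map_xShift, ← bondHopping_swap]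

/-- On the orbitals: the horizontal bond hopping pulled back along the diagonal reflection is the VERTICAL bond
hopping. [folklore] -/
theorem bondHopping_plaquetteBonds_diagSwap :
    (fun i j : Orb PlaquetteSite =>
        bondHopping plaquetteBonds (Orb.mapEquiv plaquetteDiagSwap i) (Orb.mapEquiv plaquetteDiagSwap j)) =
      bondHopping plaquetteBondsV := by
  funext i j
  rw [bondHopping_mapEquiv, plaquetteBonds_map_diagSwap]

/-! ### Symmetry-adapted plaquette states (from (W4), no symmetry labels needed) -/

/-- **The plaquette states are symmetry-adapted for `U ∈ [2, 4]`.** For every automorphism `f` of the plaquette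
graph, the second-quantised symmetry `Γ_f = fockMapOp (Orb.mapEquiv f)` maps each of `|0h⟩ = plaquetteVacuum U`,
`|2h⟩ = plaquettePair U` to a unimodular multiple of itself: `Γ_f` commutes with `H`, `N`, `S^z`, so it permutes the
`(4,0)` and `(2,0)` sector ground states, which are simple by (W4) (`plaquette_vacuumGS_unique`,
`plaquette_pairGS_unique`); unimodularity because `Γ_f` is an isometry and the states are normalised.
(The actual characters — `B₁g` for `|0h⟩`, `A₁` for `|2h⟩`, Tsai–Kivelson 2006 Table I — are not needed.)
[cite: YaoTsaiKivelson2007, p. 2] -/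
theorem plaquetteStates_eigenphase (hU : U ∈ Set.Icc (2 : ℝ) 4) (f : PlaquetteSite ≃ PlaquetteSite)
    (hG : ∀ x y, plaquetteGraph.Adj (f x) (f y) ↔ plaquetteGraph.Adj x y) :
    ∃ u : Fin 2 → ℂ, (∀ k, star (u k) * u k = 1) ∧
      ∀ k, fockMapOp (Orb.mapEquiv f) *ᵥ plaquetteStates U k = u k • plaquetteStates U k := by
  -- `Γᴴ Γ = 1` (stated by the lemma itself, to keep its `DecidableEq` instance)
  have hΓ := conjTranspose_fockMapOp_mul_self (⇑(Orb.mapEquiv f)) (Orb.mapEquiv f).injective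
  -- `Γ |0h⟩` and `Γ |2h⟩` are again normalised sector ground states
  have h0 := (plaquetteVacuum_spec U).2.fockMapOp_mapEquiv_mulVec plaquetteGraph f hG
  have h1 := (plaquettePair_spec U).2.fockMapOp_mapEquiv_mulVec plaquetteGraph f hG
  obtain ⟨a₀, ha₀⟩ := plaquette_vacuumGS_unique hU _ _ (plaquetteVacuum_spec U).2 h0
  obtain ⟨a₁, ha₁⟩ := plaquette_pairGS_unique hU _ _ (plaquettePair_spec U).2 h1
  refine ⟨![a₀, a₁], ?_, ?_⟩
  · intro k
    fin_cases k
    · exact star_mul_self_eq_one_of_isometry_mulVec_eq_smul hΓ (plaquetteVacuum_spec U).1 ha₀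
    · exact star_mul_self_eq_one_of_isometry_mulVec_eq_smul hΓ (plaquettePair_spec U).1 ha₁
  · intro k
    fin_cases k
    · exact ha₀
    · exact ha₁

/-- **Diagonal entries are invariant under pulling the bonds back along a plaquette automorphism**, `U ∈ [2, 4]`:
`K_{W∘(f×f)}(κ, κ) = K_W(κ, κ)` for `W = bondHopping plaquetteBonds` and the chosen plaquette states
(`interClusterKernel_comp_eq_of_eigenphase_diag` with `Γ = fockMapOp (Orb.mapEquiv f)`).
[cite: TsaiKivelson2006, App. A (A1)] -/
theorem plaquetteKernel_mapEquiv_diag (hU : U ∈ Set.Icc (2 : ℝ) 4) (f : PlaquetteSite ≃ PlaquetteSite)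
    (hG : ∀ x y, plaquetteGraph.Adj (f x) (f y) ↔ plaquetteGraph.Adj x y) (κ : Fin 2 × Fin 2) :
    interClusterKernel (plaquetteHamiltonian_isHermitian U) (plaquetteStates U)
        (fun i j => bondHopping plaquetteBonds (Orb.mapEquiv f i) (Orb.mapEquiv f j)) κ κ =
      plaquetteKernel U κ κ := by
  obtain ⟨u, hu, hφ⟩ := plaquetteStates_eigenphase hU f hG
  exact interClusterKernel_comp_eq_of_eigenphase_diag (plaquetteHamiltonian_isHermitian U) (plaquetteStates U)
    (bondHopping plaquetteBonds) (conjTranspose_fockMapOp_mul_self _ (Orb.mapEquiv f).injective)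
    (fockMapOp_mapEquiv_mul_hamiltonian plaquetteGraph plaquetteGraph f hG 1 U) (Orb.mapEquiv f)
    (fun i => fockMapOp_mul_annihilation _ (Orb.mapEquiv f).bijective i)
    (fun i => fockMapOp_mul_creation _ i) u hu hφ κ

/-- **Exchange entries are invariant under pulling the bonds back along a plaquette automorphism**, `U ∈ [2, 4]`:
`K_{W∘(f×f)}((k,l),(l,k)) = K_W((k,l),(l,k))`. [cite: TsaiKivelson2006, App. A (A1)] -/
theorem plaquetteKernel_mapEquiv_exchange (hU : U ∈ Set.Icc (2 : ℝ) 4) (f : PlaquetteSite ≃ PlaquetteSite)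
    (hG : ∀ x y, plaquetteGraph.Adj (f x) (f y) ↔ plaquetteGraph.Adj x y) (k l : Fin 2) :
    interClusterKernel (plaquetteHamiltonian_isHermitian U) (plaquetteStates U)
        (fun i j => bondHopping plaquetteBonds (Orb.mapEquiv f i) (Orb.mapEquiv f j)) (k, l) (l, k) =
      plaquetteKernel U (k, l) (l, k) := by
  obtain ⟨u, hu, hφ⟩ := plaquetteStates_eigenphase hU f hG
  exact interClusterKernel_comp_eq_of_eigenphase_exchange (plaquetteHamiltonian_isHermitian U) (plaquetteStates U)
    (bondHopping plaquetteBonds) (conjTranspose_fockMapOp_mul_self _ (Orb.mapEquiv f).injective)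
    (fockMapOp_mapEquiv_mul_hamiltonian plaquetteGraph plaquetteGraph f hG 1 U) (Orb.mapEquiv f)
    (fun i => fockMapOp_mul_annihilation _ (Orb.mapEquiv f).bijective i)
    (fun i => fockMapOp_mul_creation _ i) u hu hφ k l

/-! ### Reflection symmetry of the shifts and reality of the pair hopping -/

/-- **Reflection symmetry of the second-order shifts**, `U ∈ [2, 4]`: `K((k,l),(k,l)) = K((l,k),(l,k))` — the shift
of `k` hole pairs on `R` and `l` on `R' = R + 2e₁` equals that of the mirror configuration. Proof: the cluster
exchange turns `K_W((k,l),(k,l))` into `K_{Wᵀ}((l,k),(l,k))` (`interClusterKernel_swap_diag`), and `Wᵀ` is the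
pull-back of `W` along the horizontal shift, under which diagonal entries are invariant.
[cite: TsaiKivelson2006, App. A (A1)] -/
theorem plaquetteKernel_reflect (hU : U ∈ Set.Icc (2 : ℝ) 4) (k l : Fin 2) :
    plaquetteKernel U (k, l) (k, l) = plaquetteKernel U (l, k) (l, k) := by
  rw [plaquetteKernel, ← interClusterKernel_swap_diag (plaquetteHamiltonian_isHermitian U) (plaquetteStates U)
    (bondHopping plaquetteBonds) k l, ← bondHopping_plaquetteBonds_xShift]
  exact plaquetteKernel_mapEquiv_diag hU plaquetteXShift plaquetteGraph_adj_xShift (l, k)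

/-- **`δE(1,0) = δE(0,1)`** (real parts), the hypothesis of `plaquettePairCouplings_V_eq_of_symm`, `U ∈ [2, 4]`.
[cite: TsaiKivelson2006, App. A (A1)] -/
theorem plaquetteKernel_reflect_re (hU : U ∈ Set.Icc (2 : ℝ) 4) :
    (plaquetteKernel U (1, 0) (1, 0)).re = (plaquetteKernel U (0, 1) (0, 1)).re := by
  rw [plaquetteKernel_reflect hU 1 0]

/-- Hence the requested form of the pair–pair interaction, `V = δE(1,1) + δE(0,0) - 2 δE(1,0)`, `U ∈ [2, 4]`
(Yao–Tsai–Kivelson 2007, eq. (2): `V⁽¹⁾`). [cite: YaoTsaiKivelson2007, eq. (2)] -/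
theorem plaquettePairCouplings_V_eq (hU : U ∈ Set.Icc (2 : ℝ) 4) :
    (plaquettePairCouplings U).V =
      (plaquetteKernel U (1, 1) (1, 1)).re + (plaquetteKernel U (0, 0) (0, 0)).re -
        2 * (plaquetteKernel U (1, 0) (1, 0)).re :=
  plaquettePairCouplings_V_eq_of_symm U (plaquetteKernel_reflect_re hU)

/-- The two `O(t'²)` one-body shifts of the bond agree: `μ = Re [K(1,0) - K(0,0)] = Re [K(0,1) - K(0,0)] = μ'`,
`U ∈ [2, 4]`. [cite: YaoTsaiKivelson2007, eq. (2)] -/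
theorem plaquettePairCouplings_mu_symm (hU : U ∈ Set.Icc (2 : ℝ) 4) :
    (plaquettePairCouplings U).μ = (plaquetteKernel U (0, 1) (0, 1)).re - (plaquetteKernel U (0, 0) (0, 0)).re := by
  simp only [plaquettePairCouplings]
  rw [plaquetteKernel_reflect_re hU]

/-- **The exchange entries are real**, `U ∈ [2, 4]`: `Im K((k,l),(l,k)) = 0`. Proof: pulling `W` back along the
horizontal shift fixes the exchange entry (`plaquetteKernel_mapEquiv_exchange`) and produces `Wᵀ`, while the cluster
exchange identifies `K_{Wᵀ}((k,l),(l,k))` with the complex CONJUGATE `conj K_W((k,l),(l,k))`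
(`interClusterKernel_swap_exchange`); a number equal to its conjugate is real. (For a real Hamiltonian and real states
every entry is real; here no reality of the chosen states is needed.) [cite: TsaiKivelson2006, App. A (A1)] -/
theorem plaquetteKernel_exchange_im (hU : U ∈ Set.Icc (2 : ℝ) 4) (k l : Fin 2) :
    (plaquetteKernel U (k, l) (l, k)).im = 0 := by
  have h : plaquetteKernel U (k, l) (l, k) = star (plaquetteKernel U (k, l) (l, k)) := by
    conv_lhs => rw [← plaquetteKernel_mapEquiv_exchange hU plaquetteXShift plaquetteGraph_adj_xShift k l,
      bondHopping_plaquetteBonds_xShift]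
    exact interClusterKernel_swap_exchange (plaquetteHamiltonian_isHermitian U) (plaquetteStates U)
      (bondHopping plaquetteBonds) k l
  have him := congrArg Complex.im h
  rw [Complex.star_def, Complex.conj_im] at him
  linarith

/-- **The pair-hopping entry is exactly `-J(U)`**, `U ∈ [2, 4]`: `K((1,0),(0,1)) = -J` as complex numbers (its real
part is `-J` by definition, `plaquetteKernel_hop_re`; its imaginary part vanishes). This is what clause (d) of the
dictionary needs to match `⟨1,0| 2J · xxzHamiltonian … |0,1⟩ = 2J · (-½) = -J`.
[cite: YaoTsaiKivelson2007, eq. (2)] -/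
theorem plaquetteKernel_hop_eq_neg_J (hU : U ∈ Set.Icc (2 : ℝ) 4) :
    plaquetteKernel U (1, 0) (0, 1) = -(((plaquettePairCouplings U).J : ℝ) : ℂ) := by
  refine Complex.ext ?_ ?_
  · rw [plaquetteKernel_hop_re, Complex.neg_re, Complex.ofReal_re]
  · rw [plaquetteKernel_exchange_im hU 1 0, Complex.neg_im, Complex.ofReal_im, neg_zero]

/-- The reverse hopping entry is the same real number: `K((0,1),(1,0)) = -J(U)`, `U ∈ [2, 4]` (Hermiticity).
[cite: YaoTsaiKivelson2007, eq. (2)] -/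
theorem plaquetteKernel_hop'_eq_neg_J (hU : U ∈ Set.Icc (2 : ℝ) 4) :
    plaquetteKernel U (0, 1) (1, 0) = -(((plaquettePairCouplings U).J : ℝ) : ℂ) := by
  rw [← star_plaquetteKernel, plaquetteKernel_hop_eq_neg_J hU, star_neg, Complex.star_def, Complex.conj_ofReal]

/-! ### Isotropy: vertically adjacent plaquettes have the same couplings -/

/-- **Isotropy of the second-order shifts**, `U ∈ [2, 4]`: Kato's kernel of two VERTICALLY adjacent plaquettes
(`R` below `R' = R + 2e₂`, bonds `plaquetteBondsV`, the same plaquette states) has the same diagonal entries as the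
horizontal kernel `plaquetteKernel U`: the diagonal reflection of the plaquette carries the horizontal bonds onto the
vertical ones and acts on the simple plaquette states by phases. So `V`, `μ` and the constant `K(0,0)` are the same
for horizontal and vertical superlattice bonds — the boson model of Yao–Tsai–Kivelson 2007, eq. (2) is isotropic.
[cite: YaoTsaiKivelson2007, eq. (2)] -/
theorem plaquetteKernel_vertical_diag (hU : U ∈ Set.Icc (2 : ℝ) 4) (κ : Fin 2 × Fin 2) :
    interClusterKernel (plaquetteHamiltonian_isHermitian U) (plaquetteStates U) (bondHopping plaquetteBondsV) κ κ =
      plaquetteKernel U κ κ := by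
  rw [← bondHopping_plaquetteBonds_diagSwap]
  exact plaquetteKernel_mapEquiv_diag hU plaquetteDiagSwap plaquetteGraph_adj_diagSwap κ

/-- **Isotropy of the pair hopping**, `U ∈ [2, 4]`: the vertical kernel has the same exchange entries as the
horizontal one; in particular the vertical pair hopping is `-J(U)` as well (`plaquetteKernel_vertical_hop`).
[cite: YaoTsaiKivelson2007, eq. (2)] -/
theorem plaquetteKernel_vertical_exchange (hU : U ∈ Set.Icc (2 : ℝ) 4) (k l : Fin 2) :
    interClusterKernel (plaquetteHamiltonian_isHermitian U) (plaquetteStates U) (bondHopping plaquetteBondsV)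
        (k, l) (l, k) = plaquetteKernel U (k, l) (l, k) := by
  rw [← bondHopping_plaquetteBonds_diagSwap]
  exact plaquetteKernel_mapEquiv_exchange hU plaquetteDiagSwap plaquetteGraph_adj_diagSwap k l

/-- The vertical pair-hopping amplitude equals the horizontal one: `K_V((1,0),(0,1)) = -J(U)`, `U ∈ [2, 4]`.
[cite: YaoTsaiKivelson2007, eq. (2)] -/
theorem plaquetteKernel_vertical_hop (hU : U ∈ Set.Icc (2 : ℝ) 4) :
    interClusterKernel (plaquetteHamiltonian_isHermitian U) (plaquetteStates U) (bondHopping plaquetteBondsV)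
        (1, 0) (0, 1) = -(((plaquettePairCouplings U).J : ℝ) : ℂ) := by
  rw [plaquetteKernel_vertical_exchange hU 1 0, plaquetteKernel_hop_eq_neg_J hU]

/-! ### Choice independence: `J`, `V`, `μ`, `c` are functions of `U` alone -/

/-- Any normalised ground state of a simple sector is a unimodular multiple of the chosen one. [folklore] -/
theorem exists_unitPhase_of_unique {H : Matrix (Finset (Orb PlaquetteSite)) (Finset (Orb PlaquetteSite)) ℂ}
    {N : ℕ} {M : ℝ} {φ ψ : Fock (Orb PlaquetteSite)}
    (huniq : ∀ φ₁ φ₂ : Fock (Orb PlaquetteSite), IsGroundStateInSector H N M φ₁ → IsGroundStateInSector H N M φ₂ →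
      ∃ a : ℂ, φ₂ = a • φ₁)
    (hφ : star φ ⬝ᵥ φ = 1 ∧ IsGroundStateInSector H N M φ) (hψ : star ψ ⬝ᵥ ψ = 1 ∧ IsGroundStateInSector H N M ψ) :
    ∃ a : ℂ, star a * a = 1 ∧ ψ = a • φ := by
  obtain ⟨a, ha⟩ := huniq φ ψ hφ.2 hψ.2
  refine ⟨a, ?_, ha⟩
  have h := hψ.1
  rw [ha, star_smul, smul_dotProduct, dotProduct_smul, hφ.1, smul_eq_mul, smul_eq_mul, mul_one] at h
  exact h

/-- **Choice independence of the shifts**, `U ∈ [2, 4]`: for ANY normalised ground states `φ₀` of the `(4,0)` sector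
and `φ₁` of the `(2,0)` sector, the kernel built from `![φ₀, φ₁]` has the same diagonal entries as `plaquetteKernel U`
(gauge invariance `interClusterKernel_unitPhase_diag`; the states differ from the chosen ones by unimodular phases by
(W4)). So `V(U)`, `μ(U)` do not depend on the choices made in `plaquetteVacuum`, `plaquettePair`.
[cite: TsaiKivelson2006, App. A (A1)] -/
theorem plaquetteKernel_choice_diag (hU : U ∈ Set.Icc (2 : ℝ) 4) {φ₀ φ₁ : Fock (Orb PlaquetteSite)}
    (h₀ : star φ₀ ⬝ᵥ φ₀ = 1 ∧ IsGroundStateInSector (plaquetteHamiltonian U) 4 0 φ₀)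
    (h₁ : star φ₁ ⬝ᵥ φ₁ = 1 ∧ IsGroundStateInSector (plaquetteHamiltonian U) 2 0 φ₁) (κ : Fin 2 × Fin 2) :
    interClusterKernel (plaquetteHamiltonian_isHermitian U) ![φ₀, φ₁] (bondHopping plaquetteBonds) κ κ =
      plaquetteKernel U κ κ := by
  obtain ⟨a₀, ha₀, e₀⟩ := exists_unitPhase_of_unique (plaquette_vacuumGS_unique hU) (plaquetteVacuum_spec U) h₀
  obtain ⟨a₁, ha₁, e₁⟩ := exists_unitPhase_of_unique (plaquette_pairGS_unique hU) (plaquettePair_spec U) h₁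
  have hfun : (![φ₀, φ₁] : Fin 2 → Fock (Orb PlaquetteSite)) = fun k => (![a₀, a₁] : Fin 2 → ℂ) k • plaquetteStates U k := by
    funext k
    fin_cases k
    · exact e₀
    · exact e₁
  have hu : ∀ k, star ((![a₀, a₁] : Fin 2 → ℂ) k) * (![a₀, a₁] : Fin 2 → ℂ) k = 1 := by
    intro k
    fin_cases k
    · exact ha₀
    · exact ha₁
  rw [hfun, plaquetteKernel]
  exact interClusterKernel_unitPhase_diag (plaquetteHamiltonian_isHermitian U) (plaquetteStates U)
    (bondHopping plaquetteBonds) _ hu κ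

/-- **Choice independence of the pair hopping**, `U ∈ [2, 4]`: for ANY normalised sector ground states the exchange
entries agree with those of `plaquetteKernel U`; in particular `-Re K'((1,0),(0,1)) = J(U)`
(`interClusterKernel_unitPhase_exchange`). [cite: YaoTsaiKivelson2007, eq. (2)] -/
theorem plaquetteKernel_choice_exchange (hU : U ∈ Set.Icc (2 : ℝ) 4) {φ₀ φ₁ : Fock (Orb PlaquetteSite)}
    (h₀ : star φ₀ ⬝ᵥ φ₀ = 1 ∧ IsGroundStateInSector (plaquetteHamiltonian U) 4 0 φ₀)
    (h₁ : star φ₁ ⬝ᵥ φ₁ = 1 ∧ IsGroundStateInSector (plaquetteHamiltonian U) 2 0 φ₁) (k l : Fin 2) :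
    interClusterKernel (plaquetteHamiltonian_isHermitian U) ![φ₀, φ₁] (bondHopping plaquetteBonds) (k, l) (l, k) =
      plaquetteKernel U (k, l) (l, k) := by
  obtain ⟨a₀, ha₀, e₀⟩ := exists_unitPhase_of_unique (plaquette_vacuumGS_unique hU) (plaquetteVacuum_spec U) h₀
  obtain ⟨a₁, ha₁, e₁⟩ := exists_unitPhase_of_unique (plaquette_pairGS_unique hU) (plaquettePair_spec U) h₁
  have hfun : (![φ₀, φ₁] : Fin 2 → Fock (Orb PlaquetteSite)) = fun k => (![a₀, a₁] : Fin 2 → ℂ) k • plaquetteStates U k := by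
    funext k
    fin_cases k
    · exact e₀
    · exact e₁
  have hu : ∀ k, star ((![a₀, a₁] : Fin 2 → ℂ) k) * (![a₀, a₁] : Fin 2 → ℂ) k = 1 := by
    intro k
    fin_cases k
    · exact ha₀
    · exact ha₁
  rw [hfun, plaquetteKernel]
  exact interClusterKernel_unitPhase_exchange (plaquetteHamiltonian_isHermitian U) (plaquetteStates U)
    (bondHopping plaquetteBonds) _ hu k l

/-- **Choice independence of the `d`-wave weight**, `U ∈ [2, 4]`: for ANY normalised sector ground states,
`‖⟨φ₁, Δ_d^{(R)} φ₀⟩‖ = c(U)`. [cite: TsaiKivelson2006, Table I] -/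
theorem plaquetteDWaveOverlap_choice (hU : U ∈ Set.Icc (2 : ℝ) 4) {φ₀ φ₁ : Fock (Orb PlaquetteSite)}
    (h₀ : star φ₀ ⬝ᵥ φ₀ = 1 ∧ IsGroundStateInSector (plaquetteHamiltonian U) 4 0 φ₀)
    (h₁ : star φ₁ ⬝ᵥ φ₁ = 1 ∧ IsGroundStateInSector (plaquetteHamiltonian U) 2 0 φ₁) :
    ‖star φ₁ ⬝ᵥ (plaquetteDWavePair *ᵥ φ₀)‖ = (plaquettePairCouplings U).c := by
  obtain ⟨a₀, ha₀, e₀⟩ := exists_unitPhase_of_unique (plaquette_vacuumGS_unique hU) (plaquetteVacuum_spec U) h₀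
  obtain ⟨a₁, ha₁, e₁⟩ := exists_unitPhase_of_unique (plaquette_pairGS_unique hU) (plaquettePair_spec U) h₁
  have hn : ∀ a : ℂ, star a * a = 1 → ‖a‖ = 1 := by
    intro a ha
    have h2 : ‖a‖ ^ 2 = 1 := by
      have := congrArg Complex.re ha
      rw [Complex.star_def, Complex.conj_mul', Complex.one_re] at this
      exact_mod_cast this
    nlinarith [norm_nonneg a]
  rw [e₀, e₁, mulVec_smul, star_smul, smul_dotProduct, dotProduct_smul, smul_eq_mul, smul_eq_mul, norm_mul,
    norm_mul, norm_star, hn a₀ ha₀, hn a₁ ha₁, one_mul, one_mul, ← plaquetteDWaveOverlap, plaquetteDWaveOverlap_eq_c,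
    Complex.norm_real, Real.norm_of_nonneg (plaquettePairCouplings_c_nonneg U)]

end KernelSymmetry

/-! ### Registered sub-goal stubs of stmt-HubbardSuperconductivity-8148 (signatures verbatim) -/

/-- Registered sub-goal `dressHalfFilled_kernelReflect` (stub-2 groundwork): reflection symmetry of the two-plaquette
second-order shifts for `U ∈ [2,4]`, `K((k,l),(k,l)) = K((l,k),(l,k))`. [cite: TsaiKivelson2006, App. A (A1)] -/
theorem dressHalfFilled_kernelReflect : ∀ {U : ℝ}, U ∈ Set.Icc (2 : ℝ) 4 → ∀ k l : Fin 2, Literature.MathematicalPhysics.QuantumLattice.plaquetteKernel U (k, l) (k, l) = Literature.MathematicalPhysics.QuantumLattice.plaquetteKernel U (l, k) (l, k) :=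
  fun hU k l => plaquetteKernel_reflect hU k l

/-- Registered sub-goal `dressHalfFilled_kernelHopReal` (stub-2 groundwork): the pair-hopping entry of the
two-plaquette kernel is the real number `-J(U)` for `U ∈ [2,4]`. [cite: YaoTsaiKivelson2007, eq. (2)] -/
theorem dressHalfFilled_kernelHopReal : ∀ {U : ℝ}, U ∈ Set.Icc (2 : ℝ) 4 → Literature.MathematicalPhysics.QuantumLattice.plaquetteKernel U (1, 0) (0, 1) = -(((Literature.MathematicalPhysics.QuantumLattice.plaquettePairCouplings U).J : ℝ) : ℂ) :=
  fun hU => plaquetteKernel_hop_eq_neg_J hU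

/-- Registered sub-goal `dressHalfFilled_kernelIsotropic` (stub-2 groundwork): the second-order kernel of two
vertically adjacent plaquettes (bonds `((x,1),(x,0))`, `x = 0,1`) has the same shifts and the same pair hopping as the
horizontal one, `U ∈ [2,4]`. [cite: YaoTsaiKivelson2007, eq. (2)] -/
theorem dressHalfFilled_kernelIsotropic : ∀ {U : ℝ}, U ∈ Set.Icc (2 : ℝ) 4 → (∀ κ : Fin 2 × Fin 2, Literature.MathematicalPhysics.QuantumLattice.interClusterKernel (Literature.MathematicalPhysics.QuantumLattice.plaquetteHamiltonian_isHermitian U) (Literature.MathematicalPhysics.QuantumLattice.plaquetteStates U) (Literature.MathematicalPhysics.QuantumLattice.bondHopping ({(toLex ![0, 1], toLex ![0, 0]), (toLex ![1, 1], toLex ![1, 0])} : Finset (Literature.MathematicalPhysics.QuantumLattice.PlaquetteSite × Literature.MathematicalPhysics.QuantumLattice.PlaquetteSite))) κ κ = Literature.MathematicalPhysics.QuantumLattice.plaquetteKernel U κ κ) ∧ Literature.MathematicalPhysics.QuantumLattice.interClusterKernel (Literature.MathematicalPhysics.QuantumLattice.plaquetteHamiltonian_isHermitian U) (Literature.MathematicalPhysics.QuantumLattice.plaquetteStates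 U) (Literature.MathematicalPhysics.QuantumLattice.bondHopping ({(toLex ![0, 1], toLex ![0, 0]), (toLex ![1, 1], toLex ![1, 0])} : Finset (Literature.MathematicalPhysics.QuantumLattice.PlaquetteSite × Literature.MathematicalPhysics.QuantumLattice.PlaquetteSite))) (1, 0) (0, 1) = -(((Literature.MathematicalPhysics.QuantumLattice.plaquettePairCouplings U).J : ℝ) : ℂ) :=
  fun hU => ⟨fun κ => plaquetteKernel_vertical_diag hU κ, plaquetteKernel_vertical_hop hU⟩

end Summit.HubbardSuperconductivity.HubbardSuperconductivity.Theorems.LevyLogBootstrap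

end
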